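import Literature.ComputerArithmetic.JeannerodRump2018.OptimalBound

/-!
# Lange–Rump 2019, Theorem 10 (uniform form) PROVED: recursive summation for EVERY `n`, factor `< 1`

HONEST FRAMING (venture CertifiedArithmetic / cell `pub-lowprec`): certified error envelopes and
provably optimal rounding/accumulation schemes for low-precision formats under stated cost models;
every table by two implementations; no hardware or vendor claims.

[LangeRump2018, Thm 10] (M. Lange, S. M. Rump, *Sharp estimates for perturbation errors in
summations*, Math. Comp. 88 (2019), §5): for RECURSIVE summation `s₁ = x₁`, `sₖ = sₖ₋₁ +̃ xₖ`
with local errors `δₖ` satisfying only `|δₖ| ≤ |xₖ|`, and `ξₖ := |δₖ|/(Σ_{i≤k}|xᵢ| + Σ_{i<k}|δᵢ|)`,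
`qₙ := Π (1-ξᵢ)/(1+ξᵢ)`: `|sₙ - Σxᵢ| ≤ Σ|δᵢ| ≤ (1-qₙ)/(1+qₙ)·Σ|xᵢ|` — for every `n`, and
`(1-qₙ)/(1+qₙ) ≤ Σξᵢ ≤ Σ|εᵢ|` ((31)).

PROVED here, over the number system of `JeannerodRump2018/Summation.lean` (precision `p ≥ 1`,
gradual underflow, no overflow, any round-to-nearest `fl`), in the UNIFORM form obtained from the
nearest-addition facts `|δₖ| ≤ |xₖ|` ([LangeRump2018, (7)]) and `|δₖ| ≤ u/(1+u)·|sₖ₋₁ + xₖ|`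
(so every `ξₖ ≤ u/(1+u)` and `qₙ ≥ (1+2u)^{-n}`): for `a, x₁, …, xₙ ∈ F`,
  `|foldl (· +̃ ·) a [x₁,…,xₙ] - (a + Σxᵢ)| ≤ ((1+2u)ⁿ - 1)/((1+2u)ⁿ + 1) · (|a| + Σ|xᵢ|)`
(`theorem10_uniform`) — NO restriction on `n`, factor `< 1` always and `≤ n·u/(1+u)`. Recursive
summation is written with `List.foldl` so that no new definition is needed. The proof is the
paper's two-case induction ((32)/(34)) on the accumulated error. Not here: the data-dependent
`qₙ` form, its sharpness (35), (31).
-/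

namespace Literature.ComputerArithmetic.LangeRump2018

open Literature.ComputerArithmetic.JeannerodRump2018

variable {p : ℕ} {emin : ℤ} {fl : ℚ → ℚ}

/-- The recursive floating-point sum of `a, x₁, …, xₙ` is a float. [cite: LangeRump2018, §5] -/
theorem isFloat_foldl (hfl : IsRoundNearest p emin fl) (a : ℚ) (ha : IsFloat p emin a) :
    ∀ l : List ℚ, IsFloat p emin (l.foldl (fun s x => fl (s + x)) a) := by
  intro l
  induction l using List.reverseRecOn with
  | nil => simpa using ha
  | append_singleton l x ih =>
      rw [List.foldl_append, List.foldl_cons, List.foldl_nil]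
      exact (hfl _).1

/-- `|Σ l| ≤ Σ |l|` for lists. [cite: LangeRump2018, §5] -/
theorem abs_list_sum_le : ∀ l : List ℚ, |l.sum| ≤ (l.map abs).sum
  | [] => by simp
  | x :: l => by
      simp only [List.sum_cons, List.map_cons]
      exact le_trans (abs_add_le _ _) (add_le_add le_rfl (abs_list_sum_le l))

/-- The recursion identity behind Theorem 10's induction, uniform form: with `ū = u/(1+u)` and
`r = 1 + 2u`, `ū + (1 + ū)·(rⁿ - 1)/(rⁿ⁺¹ + 1) = (rⁿ⁺¹ - 1)/(rⁿ⁺¹ + 1)`.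
[cite: LangeRump2018, Thm 10 (proof)] -/
theorem factor_succ_identity (u : ℚ) (hu : 0 < u) (n : ℕ) :
    u / (1 + u) + (1 + u / (1 + u)) * (((1 + 2 * u) ^ n - 1) / ((1 + 2 * u) ^ (n + 1) + 1))
      = ((1 + 2 * u) ^ (n + 1) - 1) / ((1 + 2 * u) ^ (n + 1) + 1) := by
  have hr : (0 : ℚ) < (1 + 2 * u) ^ n := pow_pos (by linarith) n
  rw [pow_succ]
  field_simp
  ring

/-- THEOREM 10, uniform form [LangeRump2018] (radix 2): for `a, x₁, …, xₙ ∈ F` and recursive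
summation in any round-to-nearest arithmetic, with NO restriction on `n`,
`|ŝ - (a + Σxᵢ)| ≤ ((1+2u)ⁿ - 1)/((1+2u)ⁿ + 1) · (|a| + Σ|xᵢ|)` (`n` additions; the factor is
`< 1` and `≤ n·u/(1+u)`). [cite: LangeRump2018, Thm 10] -/
theorem theorem10_uniform (hp : 1 ≤ p) (hfl : IsRoundNearest p emin fl) (a : ℚ)
    (ha : IsFloat p emin a) :
    ∀ l : List ℚ, (∀ x ∈ l, IsFloat p emin x) →
      |l.foldl (fun s x => fl (s + x)) a - (a + l.sum)|
        ≤ ((1 + 2 * unitRoundoff p) ^ l.length - 1) / ((1 + 2 * unitRoundoff p) ^ l.length + 1)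
          * (|a| + (l.map abs).sum) := by
  intro l
  induction l using List.reverseRecOn with
  | nil => simp
  | append_singleton l x ih =>
      intro hlx
      have hl : ∀ y ∈ l, IsFloat p emin y := fun y hy => hlx y (List.mem_append_left _ hy)
      have hx : IsFloat p emin x := hlx x (by simp)
      have ihl := ih hl
      set u := unitRoundoff p with hu_def
      have hu : 0 < u := by rw [hu_def]; unfold unitRoundoff; positivity
      set ub := u / (1 + u) with hub
      have hub0 : 0 ≤ ub := div_nonneg hu.le (by linarith)
      set S := l.foldl (fun s x => fl (s + x)) a with hS
      have hSF : IsFloat p emin S := isFloat_foldl hfl a ha l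
      rw [List.foldl_append, List.foldl_cons, List.foldl_nil, ← hS, List.sum_append,
        List.sum_singleton, List.map_append, List.sum_append, List.length_append,
        List.length_singleton]
      simp only [List.map_cons, List.map_nil, List.sum_cons, List.sum_nil, add_zero]
      set E := |S - (a + l.sum)| with hE
      set T := |a| + (l.map abs).sum with hT
      have hT0 : 0 ≤ T := by
        rw [hT]
        refine add_nonneg (abs_nonneg a) (List.sum_nonneg ?_)
        intro y hy
        obtain ⟨z, _, rfl⟩ := List.mem_map.mp hy
        exact abs_nonneg z
      set d := fl (S + x) - (S + x) with hd
      have hd1 : |d| ≤ |x| := abs_err_le_abs_operand hfl hSF x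
      have hd2 : |d| ≤ ub * |S + x| := abs_err_add_le_sharp hp hfl hSF hx
      have hstep : fl (S + x) - (a + (l.sum + x)) = (S - (a + l.sum)) + d := by rw [hd]; ring
      rw [hstep]
      have harg : |S + x| ≤ T + E + |x| := by
        have h1 : |a + l.sum| ≤ T := by
          rw [hT]
          refine le_trans (abs_add_le _ _) (add_le_add le_rfl ?_)
          exact abs_list_sum_le l
        calc |S + x| = |(S - (a + l.sum)) + (a + l.sum) + x| := by ring_nf
          _ ≤ |(S - (a + l.sum)) + (a + l.sum)| + |x| := abs_add_le _ _
          _ ≤ E + T + |x| := by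
              have := abs_add_le (S - (a + l.sum)) (a + l.sum)
              linarith
          _ = T + E + |x| := by ring
      have hEtot : |(S - (a + l.sum)) + d| ≤ E + |d| := abs_add_le _ _
      set n := l.length with hn
      set rn := (1 + 2 * u) ^ n with hrn
      have hrn1 : 1 ≤ rn := one_le_pow₀ (by linarith)
      have hphi_s : ((1 + 2 * u) ^ (n + 1) - 1) / ((1 + 2 * u) ^ (n + 1) + 1)
          = (rn * (1 + 2 * u) - 1) / (rn * (1 + 2 * u) + 1) := by rw [pow_succ]
      have hid := factor_succ_identity u hu n
      rw [← hub, pow_succ, ← hrn] at hid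
      have hden1 : 0 < rn + 1 := by linarith
      have hden2 : 0 < rn * (1 + 2 * u) + 1 := by nlinarith
      set X := |x| with hX
      have hX0 : 0 ≤ X := abs_nonneg _
      have hphi0 : 0 ≤ (rn - 1) / (rn + 1) := div_nonneg (by linarith) hden1.le
      rw [hphi_s]
      by_cases hcase : 2 / (rn * (1 + 2 * u) + 1) * (T + X) ≤ 2 / (rn + 1) * T
      · have h1 : E + |d| ≤ X + (rn - 1) / (rn + 1) * T := by linarith
        have h2 : X + (rn - 1) / (rn + 1) * T = (T + X) - 2 / (rn + 1) * T := by
          field_simp; ring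
        have h3 : (rn * (1 + 2 * u) - 1) / (rn * (1 + 2 * u) + 1) * (T + X)
            = (T + X) - 2 / (rn * (1 + 2 * u) + 1) * (T + X) := by
          field_simp; ring
        calc |(S - (a + l.sum)) + d| ≤ E + |d| := hEtot
          _ ≤ (T + X) - 2 / (rn + 1) * T := by rw [← h2]; exact h1
          _ ≤ (T + X) - 2 / (rn * (1 + 2 * u) + 1) * (T + X) := by linarith
          _ = (rn * (1 + 2 * u) - 1) / (rn * (1 + 2 * u) + 1) * (T + X) := h3.symm
          _ = (rn * (1 + 2 * u) - 1) / (rn * (1 + 2 * u) + 1) * (|a| + ((l.map abs).sum + X)) := by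
              rw [hT, add_assoc]
      · have hc : 2 / (rn + 1) * T < 2 / (rn * (1 + 2 * u) + 1) * (T + X) := not_le.mp hcase
        have hT' : T ≤ (rn + 1) / (rn * (1 + 2 * u) + 1) * (T + X) := by
          have e1 : (rn + 1) / 2 * (2 / (rn + 1) * T) = T := by field_simp
          have e2 : (rn + 1) / 2 * (2 / (rn * (1 + 2 * u) + 1) * (T + X))
              = (rn + 1) / (rn * (1 + 2 * u) + 1) * (T + X) := by field_simp
          have := mul_lt_mul_of_pos_left hc (by positivity : (0 : ℚ) < (rn + 1) / 2)
          rw [e1, e2] at this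
          exact this.le
        have h1 : E + |d| ≤ ub * (T + X) + (1 + ub) * E := by
          have := le_trans hd2 (mul_le_mul_of_nonneg_left harg hub0)
          nlinarith
        have h3 : (rn - 1) / (rn + 1) * T
            ≤ (rn - 1) / (rn + 1) * ((rn + 1) / (rn * (1 + 2 * u) + 1) * (T + X)) :=
          mul_le_mul_of_nonneg_left hT' hphi0
        have h4 : (rn - 1) / (rn + 1) * ((rn + 1) / (rn * (1 + 2 * u) + 1) * (T + X))
            = (rn - 1) / (rn * (1 + 2 * u) + 1) * (T + X) := by field_simp
        calc |(S - (a + l.sum)) + d| ≤ E + |d| := hEtot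
          _ ≤ ub * (T + X) + (1 + ub) * ((rn - 1) / (rn * (1 + 2 * u) + 1) * (T + X)) := by
              have := mul_le_mul_of_nonneg_left (le_trans (le_trans ihl h3) (le_of_eq h4))
                (by linarith : (0:ℚ) ≤ 1 + ub)
              linarith
          _ = (ub + (1 + ub) * ((rn - 1) / (rn * (1 + 2 * u) + 1))) * (T + X) := by ring
          _ = (rn * (1 + 2 * u) - 1) / (rn * (1 + 2 * u) + 1) * (T + X) := by rw [hid]
          _ = (rn * (1 + 2 * u) - 1) / (rn * (1 + 2 * u) + 1) * (|a| + ((l.map abs).sum + X)) := by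
              rw [hT, add_assoc]

/-- The factor of Theorem 10 is `< 1` for every `n`. [cite: LangeRump2018, Thm 10] -/
theorem factor_lt_one {u : ℚ} (hu : 0 < u) (n : ℕ) :
    ((1 + 2 * u) ^ n - 1) / ((1 + 2 * u) ^ n + 1) < 1 := by
  have hr : (0 : ℚ) < (1 + 2 * u) ^ n := pow_pos (by linarith) n
  rw [div_lt_one (by linarith)]; linarith

/-- … and never exceeds Jeannerod–Rump's `n·u/(1+u)` ((31) with `ξᵢ ≤ u/(1+u)`).
[cite: LangeRump2018, Thm 10, (31)] -/
theorem factor_le_mul {u : ℚ} (hu : 0 < u) (n : ℕ) :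
    ((1 + 2 * u) ^ n - 1) / ((1 + 2 * u) ^ n + 1) ≤ (n : ℚ) * (u / (1 + u)) := by
  induction n with
  | zero => simp
  | succ n ih =>
      rw [← factor_succ_identity u hu n]
      set ub := u / (1 + u) with hub
      set rn := (1 + 2 * u) ^ n with hrn
      have hr : (1 : ℚ) ≤ rn := one_le_pow₀ (by linarith)
      have h1 : ((1 + 2 * u) ^ n - 1) / ((1 + 2 * u) ^ (n + 1) + 1) * (1 + ub)
          ≤ (rn - 1) / (rn + 1) := by
        rw [← hrn, div_mul_eq_mul_div, div_le_div_iff₀ (by positivity) (by positivity), pow_succ,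
          ← hrn]
        have k1 : ub ≤ u := by rw [hub, div_le_iff₀ (by linarith)]; nlinarith
        have k2 : ub * rn ≤ u * rn := mul_le_mul_of_nonneg_right k1 (by linarith)
        have k3 : u ≤ u * rn := by nlinarith
        have k4 : (1 + ub) * (rn + 1) ≤ rn * (1 + 2 * u) + 1 := by nlinarith
        have k5 := mul_le_mul_of_nonneg_left k4 (by linarith : (0 : ℚ) ≤ rn - 1)
        calc (rn - 1) * (1 + ub) * (rn + 1) = (rn - 1) * ((1 + ub) * (rn + 1)) := by ring
          _ ≤ (rn - 1) * (rn * (1 + 2 * u) + 1) := k5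
      push_cast
      linarith

end Literature.ComputerArithmetic.LangeRump2018
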